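import Literature.AlgebraicGeometry.Motives.CartierDivisorOfComplementProofs
import Literature.AlgebraicGeometry.Modules.DeligneSheafHomSections
import Literature.AlgebraicGeometry.Modules.AffineVectorBundleSections
import HarnessLib

/-!
# On a regular scheme the powers `𝓘ⁿ𝒪_X` of the ideal of the complement of an affine open are line bundles
# (Görtz–Wedhorn II, Lemma 25.150: `X ∖ U` is an effective Cartier divisor)

Layer `Literature/AlgebraicGeometry/Modules` (0 named facts, no definitions, no instances, no notation).
Let `X` be a noetherian (locally noetherian suffices here) separated integral scheme all of whose local
rings are regular, `U ⊆ X` a non-empty affine open, `𝓘 = idealOfCompl U` the radical ideal sheaf of the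
closed set `X ∖ U` (Mathlib `Scheme.IdealSheafData.vanishingIdeal`, `Modules/DeligneSheafHomAffine`) and
`𝓘ⁿ𝒪_X = powIdealModule U n` (`Modules/DeligneSheafHomSections`) — the source of the Deligne homomorphisms
`𝓘ⁿ𝒪_X ⟶ M` of `Modules/DeligneSheafHomGlobal.exists_hom_app_eq` which extend the sections of a module `M`
over `U`. Görtz–Wedhorn II, Lemma 25.150: "`X ∖ U` endowed with its reduced scheme structure is an effective
Cartier divisor" — in the tree (`Motives/CartierDivisorOfComplement`, from the theorem of Auslander–Buchsbaum
`Resolution/RegularLocalRingsUFD.Matsumura1987_20_3_holds`) this is `ComplementDivisor.exists_map_eq_span`: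
on an affine chart `V ∋ x` the radical ideal `𝓘(V)` becomes principal in `𝒪_{X,x}`, generated by an
element of `𝓘(V)`. This file draws the module-theoretic consequence:

* §1 `secToIdeal_bijective` — over an affine `V`, `Γ(V, 𝓘ⁿ𝒪_X) ≅ 𝓘(V)ⁿ` (the map `secToIdeal` of
  `Modules/DeligneSheafHomSections` is bijective);
* §2 `exists_idealAt_eq_span_singleton` — every point has an affine neighbourhood `W` (a basic open of a
  chart) on which `𝓘(W) = (j)` is principal, generated by a non-zero section `j` (spreading out the local
  generator, `RingTheory/UniqueFactorizationDomain/HeightOnePrimes.exists_notMem_forall_mul_mem_of_fg`);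
* §3 **`isFiniteLocallyFree_powIdealModule`** — hence `Γ(W, 𝓘ⁿ𝒪_X) ≅ (jⁿ) ≅ Γ(W, 𝒪_X)` is free of rank
  one, and `𝓘ⁿ𝒪_X` is finite locally free (frames on basic opens,
  `Modules/AffineVectorBundleSections.exists_free_over_basicOpen_of_projective_sections`); with
  `coh_powIdealModule` this makes `𝓘ⁿ𝒪_X` a line bundle.

This is the input "`𝒪_X(-nD)` is invertible" of Kleiman's theorem (Hartshorne II Ex. 6.8: on a noetherian
integral separated regular scheme every coherent sheaf is a quotient of a finite locally free one), assembled
in `Modules/ResolutionPropertyOfRegular`. Everything is proved. Mathlib searched (pin):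
`Scheme.IdealSheafData.map_ideal_basicOpen`, `RingedSpace.isUnit_res_basicOpen`, `Ideal.span_singleton_pow`,
`LinearEquiv.toSpanNonzeroSingleton`, `IsIntegral.component_integral` (used).

## References

* U. Görtz, T. Wedhorn, *Algebraic Geometry II* (2023), Lemma 25.150 (p. 670). [GortzWedhorn2023]
* R. Hartshorne, *Algebraic Geometry*, GTM 52 (1977), II Prop. 6.11, II Ex. 6.8 (p. 149). [Hartshorne1977]
* H. Matsumura, *Commutative Ring Theory* (1986), Thm. 20.3. [Matsumura1987]
-/

noncomputable section

universe u

open CategoryTheory CategoryTheory.Limits AlgebraicGeometry TopologicalSpace Opposite Ideal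

namespace Literature.AlgebraicGeometry.Modules

open Literature.AlgebraicGeometry.Motives Literature.AlgebraicGeometry.Motives.RatFn
  Literature.AlgebraicGeometry.Morphisms Literature.RingTheory.UniqueFactorizationDomain
  Literature.AlgebraicGeometry.Resolution

-- Mathlib's algebraic-geometry files need this for `Γ(X, V)`-algebra structures on stalks
-- (`TopCat.Presheaf` versus functor types under instance transparency); cf. `Motives/CartierDivisorOfComplement`.
set_option backward.isDefEq.respectTransparency false

variable {X : Scheme.{u}}

/-! ### §1 Sections of `𝓘ⁿ𝒪_X` over an affine open -/

/-- **`Γ(V, 𝓘ⁿ𝒪_X) ≅ 𝓘(V)ⁿ` on an affine `V`**: the map `secToIdeal` (`Modules/DeligneSheafHomSections`) is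
bijective — injective because `𝓘ⁿ𝒪_X ↪ 𝒪_X` is injective on sections, surjective by `idealToSec`.
[cite: GortzWedhorn2020, Prop. 7.14 (p. 186)] -/
theorem secToIdeal_bijective {W V : X.Opens} (hV : IsAffineOpen V) (n : ℕ) :
    Function.Bijective (secToIdeal (W := W) hV n) := by
  constructor
  · intro e e' h
    have h' : secFun (W := W) n e = secFun n e' := by
      rw [← coe_secToIdeal hV n e, ← coe_secToIdeal hV n e', h]
    exact idealMulι_app_injective _ _ _ h'
  · intro x
    exact ⟨idealToSec hV n x, Subtype.ext rfl⟩

/-! ### §2 The ideal of `X ∖ U` is locally principal on a regular scheme -/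

section Regular

variable [IsIntegral X] [IsLocallyNoetherian X] [X.IsSeparated]
  (hreg : ∀ x : X, IsRegularLocalRing (X.presheaf.stalk x)) {U : X.Opens} (hU : IsAffineOpen U) [Nonempty U]

include hreg hU in
/-- **Local equations for `X ∖ U`**: on a noetherian separated integral scheme with regular local rings,
every point has an affine open neighbourhood `W` on which the radical ideal `𝓘(W)` of `X ∖ U` (`U` a
non-empty affine open) is principal, generated by a non-zero section `j` — the ideal is principal in the
factorial `𝒪_{X,x}` with height-one minimal primes (`ComplementDivisor.exists_map_eq_span`, Görtz–Wedhorn II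
Lemma 25.150 via Auslander–Buchsbaum `Matsumura1987_20_3_holds`), and a generator `j ∈ 𝓘(V)` of `𝓘(V)𝒪_{X,x}`
generates `𝓘` on a basic open neighbourhood `W = D(g) ⊆ V`. [cite: GortzWedhorn2023, Lemma 25.150 (p. 670)] -/
theorem exists_idealAt_eq_span_singleton (x₀ : X) :
    ∃ (W : X.Opens) (hW : IsAffineOpen W) (j : Γ(X, W)), x₀ ∈ W ∧ j ≠ 0 ∧ idealAt U hW = span {j} := by
  classical
  obtain ⟨V, hV, hxV, -⟩ := exists_isAffineOpen_mem_and_subset (U := ⊤) (x := x₀) trivial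
  obtain ⟨x, rfl⟩ : ∃ x : V, (x : X) = x₀ := ⟨⟨x₀, hxV⟩, rfl⟩
  clear hxV
  haveI : Nonempty V := ⟨x⟩
  haveI : IsNoetherianRing Γ(X, V) := IsLocallyNoetherian.component_noetherian ⟨V, hV⟩
  set J := (Scheme.IdealSheafData.vanishingIdeal U.compl).ideal ⟨V, hV⟩ with hJ
  haveI := hV.isLocalization_stalk x
  obtain ⟨j, hjJ, hjx⟩ := ComplementDivisor.exists_map_eq_span Matsumura1987_20_3_holds hreg hU hV x
  -- spreading out the generator to a basic open `D(g) ∋ x`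
  obtain ⟨g, hgx, Hg⟩ := exists_notMem_forall_mul_mem_of_fg (IsNoetherian.noetherian J)
    (exists_mul_eq_of_map_le_span (q := (hV.primeIdealOf x).asIdeal) (A := X.presheaf.stalk x) hjx.le)
  have hW : IsAffineOpen (X.basicOpen g) := hV.basicOpen g
  have hWV : X.basicOpen g ≤ V := X.basicOpen_le g
  have hxW : (x : X) ∈ X.basicOpen g := by
    rw [← isUnitAt_germ_iff x.2 g, ← algebraMap_stalk_eq_germ, toFunctionField_algebraMap_stalk,
      isUnitAt_algebraMap_iff hV x g]
    exact hgx
  -- `j ≠ 0`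
  have hj0 : j ≠ 0 := by
    intro h0
    apply ComplementDivisor.vanishingIdeal_ne_bot (U := U) hV
    rw [← hJ, ← le_bot_iff]
    intro a ha
    have h1 : algebraMap Γ(X, V) (X.presheaf.stalk x) a ∈ J.map (algebraMap Γ(X, V) (X.presheaf.stalk x)) :=
      mem_map_of_mem _ ha
    rw [hjx, h0, map_zero, span_singleton_eq_bot.2 rfl, mem_bot] at h1
    exact (map_eq_zero_iff _ (algebraMap_stalk_injective x)).1 h1
  -- the restriction `j|_W` generates `𝓘(W)`
  haveI : Nonempty (X.basicOpen g : X.Opens) := ⟨⟨x, hxW⟩⟩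
  refine ⟨X.basicOpen g, hW, X.presheaf.map (homOfLE hWV).op j, hxW, ?_, ?_⟩
  · rw [← algebraMap_ne_zero_iff (V := X.basicOpen g), algebraMap_map hWV, algebraMap_ne_zero_iff (V := V)]
    exact hj0
  · have e1 : idealAt U hW = J.map (X.presheaf.map (homOfLE hWV).op).hom :=
      ((idealOfCompl U).map_ideal_basicOpen ⟨V, hV⟩ g).symm
    rw [e1]
    apply le_antisymm
    · rw [map_le_iff_le_comap]
      intro a ha
      obtain ⟨b, hb⟩ := Hg a ha
      have hu : IsUnit (X.presheaf.map (homOfLE hWV).op g) := X.toRingedSpace.isUnit_res_basicOpen g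
      rw [mem_comap, mem_span_singleton']
      refine ⟨X.presheaf.map (homOfLE hWV).op b * ↑hu.unit⁻¹, ?_⟩
      have hb' : X.presheaf.map (homOfLE hWV).op g * X.presheaf.map (homOfLE hWV).op a =
          X.presheaf.map (homOfLE hWV).op j * X.presheaf.map (homOfLE hWV).op b := by
        rw [← map_mul, ← map_mul, hb]
      calc X.presheaf.map (homOfLE hWV).op b * ↑hu.unit⁻¹ * X.presheaf.map (homOfLE hWV).op j
          = ↑hu.unit⁻¹ * (X.presheaf.map (homOfLE hWV).op j * X.presheaf.map (homOfLE hWV).op b) := by ring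
        _ = ↑hu.unit⁻¹ * (X.presheaf.map (homOfLE hWV).op g * X.presheaf.map (homOfLE hWV).op a) := by
          rw [hb']
        _ = X.presheaf.map (homOfLE hWV).op a := by
          rw [← mul_assoc, IsUnit.val_inv_mul, one_mul]
    · rw [span_le, Set.singleton_subset_iff]
      exact mem_map_of_mem _ hjJ

/-! ### §3 `𝓘ⁿ𝒪_X` is finite locally free -/

include hreg hU in
/-- **On a noetherian separated integral scheme with regular local rings, `𝓘ⁿ𝒪_X` is finite locally free**
(of rank one), `𝓘` the ideal of the complement of a non-empty affine open `U` ("`X ∖ U` … is an effective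
Cartier divisor", Görtz–Wedhorn II, Lemma 25.150; "`𝓛(D)` is an invertible sheaf", Hartshorne II Prop. 6.11 /
6.13): on the neighbourhood `W` of §2, `Γ(W, 𝓘ⁿ𝒪_X) ≅ 𝓘(W)ⁿ = (jⁿ) ≅ Γ(W, 𝒪_X)` is free of rank one
(`j ≠ 0` in the domain `Γ(W, 𝒪_X)`), whence frames on basic opens. [cite: GortzWedhorn2023, Lemma 25.150 (p. 670)]
[cite: Hartshorne1977, II Prop. 6.11 and Prop. 6.13 (pp. 141–145)] -/
theorem isFiniteLocallyFree_powIdealModule (n : ℕ) : IsFiniteLocallyFree (powIdealModule U n) := by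
  intro x₀
  obtain ⟨W, hW, j, hxW, hj0, hWj⟩ := exists_idealAt_eq_span_singleton hreg hU x₀
  haveI : Nonempty W := ⟨⟨x₀, hxW⟩⟩
  have hjn : j ^ n ≠ 0 := pow_ne_zero n hj0
  have hpow : idealAt U hW ^ n = span {j ^ n} := by rw [hWj, span_singleton_pow]
  let e₁ : Γ(powIdealModule U n, W) ≃ₗ[Γ(X, W)] ↥(idealAt U hW ^ n) :=
    LinearEquiv.ofBijective _ (secToIdeal_bijective hW n)
  let e₂ : ↥(idealAt U hW ^ n) ≃ₗ[Γ(X, W)] ↥(span {j ^ n} : Ideal Γ(X, W)) := LinearEquiv.ofEq _ _ hpow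
  let e₃ : Γ(X, W) ≃ₗ[Γ(X, W)] ↥(span {j ^ n} : Ideal Γ(X, W)) :=
    LinearEquiv.toSpanNonzeroSingleton Γ(X, W) Γ(X, W) (j ^ n) hjn
  let e : Γ(powIdealModule U n, W) ≃ₗ[Γ(X, W)] Γ(X, W) := e₁.trans (e₂.trans e₃.symm)
  haveI : Module.Finite Γ(X, W) Γ(powIdealModule U n, W) := Module.Finite.equiv e.symm
  haveI : Module.Projective Γ(X, W) Γ(powIdealModule U n, W) := Module.Projective.of_equiv e.symm
  obtain ⟨r, hxr, ι, hι, hfree⟩ := exists_free_over_basicOpen_of_projective_sections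
    (isAffineLocalizing_powIdealModule (W := U) n) hW hxW
  exact ⟨X.basicOpen r, hxr, ι, hι, hfree⟩

end Regular

end Literature.AlgebraicGeometry.Modules

end
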